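import Summits.BirchSwinnertonDyer.Rank1Residual.P2.PrintCf2VLineRestrictionLocal
import Summits.BirchSwinnertonDyer.BirchSwinnertonDyer.Theorems.PrintCf2RubinValueTwoLinePinEulerFactorNorm
import Literature.NumberTheory.EllipticCurves.Muller2020.NuBranchPeriodRigidity
import Literature.NumberTheory.EllipticCurves.Muller2020.NuBranchEulerFactor
import Literature.NumberTheory.EllipticCurves.DeShalit1987.KatzPAdicLFunctionFunctionalEquation
import Literature.NumberTheory.EllipticCurves.IntSeriesValueNormRigidity
import Literature.NumberTheory.EllipticCurves.RohrlichAnticyclotomicTwistsCMForms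
import HarnessLib

/-!
# M-LINE-PIN stub (A) `stub_vLineRestriction` (crux `PrintCf2RubinValueTwo.MainConjClauseAtSplitTwoQuad`, stmt-BirchSwinnertonDyer-24086;
# skeleton `Cruxes/MainConjClauseAtSplitTwoQuad/Lines/m_line_pin.lean` l.192–232) — THE ANALYTIC RESTRICTION TO THE `v`-LINE WITH ITS
# EULER FACTOR AT `v̄`, PROVED FROM THE `v`-LINE INTERPOLATION SUPPLY

Cell `bsd-print-cf2`, discharge-interface typer `bsd-print-cf2-ty2` g36 (literature-prover seat: Summits-side helpers go to the typer's
directory `Rank1Residual/P2/`, Theses-free, no item; consumer = the `m_line_pin` prover via `import`). THEOREMS ONLY (no `def`, no named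
fact, no `sorry`, no `instance`). HONEST FRAMING: nothing here closes the crux or a registered stub by name; BSD is not proved by any of this;
no summit statement is proved by this seat.

WHAT. `vLineRestriction_of_supply`: the three conclusions of stub (A) VERBATIM —
(0) `π_v G₂ := G₂(T₁, 0) ≠ 0`; (1) `θ_K` unramified at `v̄`: `(π_v G₂) = ((1+T) − u)·(G₁)` for the stub's `τ ∈ D_v̄`, `κ₁ τ = κ₁ γ₁`,
`τ = u` on `(F/𝓞)(θ)`; (2) `θ_K` ramified at `v̄`: `(π_v G₂) = (G₁)` — on the stub's binders (DA7 frame data used: `K` imaginary quadratic,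
`2 = v v̄`, `ι ↔ v`, top-generator pair with `κ₁` unramified outside `v`, `θ` quadratic with Hecke avatar `θ_K`, exact tame sets `S ∌ v, v̄` and
`S' ∌ v`, admissible periods, `G₁ ≠ 0`), GIVEN the `v`-LINE INTERPOLATION SUPPLY `hsupply` in the exact shape announced by width seat
cf2c-w3 g6 (HOME/STATUS 2026-08-29T08:11:41Z, `VLineSupply.exists_vLineSupply`, file `Theorems/PrintCf2RubinValueTwoVLineSupply.lean`):
characters `ρ_t` with avatars `r_t` through `κ₁`, `r_t(γ₁⁻¹) = w uᵗ` (`w, u` one-units, `‖u − 1‖ < ‖2‖`, `u ≠ 1`), `θ_K⁻¹ρ_t` of type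
`(−(m₀ + N t), 0)` (`m₀, N > 0`) unramified at `v`, `ρ_t` unramified off `v`, with entire `L`-functions. The by-name closer of the stub is then
`vLineRestriction_of_supply … (VLineSupply.exists_vLineSupply …)` with `G₁ ≠ 0` from `VLineRestriction.ne_zero_of_charIdeal_map_eq_span`
(companion file) — written when the supply lands.

PROOF (de Shalit II.4.12 / II.4.16 (49)–(50) + period rigidity, as in the stub's CONTENT (i)–(iii)).
(i) `P := π_v G₂` is an `IsNuBranch ι v (insert v̄ S) κ₁ γ₁⁻¹ θ_K⁻¹ Ω Ω_p` solution (`IsKatzMeasure₂.isKatzBranch_map_constantCoeff` at the unit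
generator pair `(γ₁⁻¹, γ₂⁻¹)` + `IsKatzBranch.isNuBranch`), so `P(w uᵗ − 1) = ι⁻¹(L_{p, S v̄}(θ_K⁻¹ρ_t; Ω))·Ω_pᵐ` along the supply.
(ii) RAMIFIED: `S' = insert v̄ S` (exactness of both tame sets), so `G₁` takes the same values with `(Ω', Ω_p')`; UNRAMIFIED: `S' = S` and
`Q := (1 − C a · binomPow c₀)·G₁`, `a = θ̃((res φ₀)⁻¹) = ι⁻¹θ_K⁻¹(ϖ_v̄)`, `c₀ = κ₁(res φ₀)`, takes those values by ty2's pointwise Euler-factor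
lemma `IsNuBranch.hasValueAt_insert_of_avatarAt_inv` (p703691) fed with the avatar dictionary AT `v̄` (`VLineRestriction.exists_frob_dictionary`:
`r_t((res φ₀)⁻¹) = ι⁻¹ρ_t(ϖ_v̄)`, `θ̃((res φ₀)⁻¹) = ι⁻¹θ_K⁻¹(ϖ_v̄)`). (iii) Two integral series taking the interpolation values of the same
characters for two period pairs along the shifted nodes `w uᵗ − 1` with types affine in `t` generate the same ideal and are both non-zero as
soon as one is (`Muller2020.span_eq_span_of_interpolationValue₀_values`, `ne_zero_of_interpolationValue₀_values`, p708075 — the period ratio is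
forced to be a unit, NO unit-content / μ-input), `Q ≠ 0` because `G₁ ≠ 0` and the Euler factor has `T`-coefficient `−a c₀ ≠ 0` when its
constant term vanishes (`c₀ ≠ 0`: `VLineRestriction.apply_absGaloisRestrict_ne_one`). (iv) In case (1), `(u : ℤ₂) = θ(τ) = θ(res φ₀) = a`
and `c₀ ∈ ℤ₂ˣ` (companion file §3–§4, from the stub's `τ`), and -w6 g7's brick `EulerFactorNorm.span_one_sub_C_mul_binomPow_eq_span_of_isUnit`
(p707870) turns `(1 − u(1+T)^{c₀})` into `((1+T) − u)`.

presearch: de Shalit 1987 II Thm. 4.12 (i)–(iii) (31)–(32), II.4.16 (49)–(50), II.4.17 (52)–(54) (held, p. 66–67, 76–78); Müller 2020 Thm. 2.4,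
Def. 2.5 (arXiv p0006) — all cited in the imported files; no new fact. beyond-print theorem: no (de Shalit II.4.12 restriction along a line).

References: [deShalit1987] II Thm. 4.12, II.4.16 (49)–(50), II.4.17; [Muller2020SplitPrimeTwo] Thm. 2.4, Def. 2.5; [SerreAbelianLadic1968]
Ch. III §2.3; [Washington1997] §7.1, §13.1.
-/

noncomputable section

set_option autoImplicit false

open scoped Classical NumberField Topology
open NumberField IsDedekindDomain Field Filter
open Literature Literature.NumberTheory.GaloisRepresentations Literature.NumberTheory.EllipticCurves
open Literature.NumberTheory.EllipticCurves.KellerYin2024 Literature.NumberTheory.EllipticCurves.GreenbergVatsal2000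
open Literature.NumberTheory.EllipticCurves.DeShalit1987 Literature.NumberTheory.EllipticCurves.Muller2020
open Summit.BirchSwinnertonDyer.BirchSwinnertonDyer.Theorems Summit.BirchSwinnertonDyer.BirchSwinnertonDyer.Theorems.PrintCf2
open Summit.BirchSwinnertonDyer.BirchSwinnertonDyer.Theorems.PrintCf2.FiniteTwist

namespace Summit.BirchSwinnertonDyer.Rank1Residual.P2.VLineRestriction

variable {K : Type} [Field K] [NumberField K]

/-- A unit of the subring `unrIntegers 2 ⊆ ℂ₂` is non-zero in `ℂ₂`. [folklore] -/
theorem coe_unrIntegers_unit_ne_zero (Ωp : (unrIntegers 2)ˣ) : ((Ωp : unrIntegers 2) : ℂ_[2]) ≠ 0 := by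
  rw [Ne, ZeroMemClass.coe_eq_zero]
  exact Units.ne_zero Ωp

/-- **Stub (A) `stub_vLineRestriction` FROM THE `v`-LINE SUPPLY.** See the module docstring: (0) `π_v G₂ ≠ 0`, (1) the Euler factor
`((1+T) − u)` at `v̄` when `θ_K` is unramified at `v̄`, (2) `(π_v G₂) = (G₁)` when `θ_K` is ramified at `v̄`; binders = the stub's frame data
actually used + `G₁ ≠ 0` + the supply `hsupply` (cf2c-w3 g6's `VLineSupply.exists_vLineSupply` output, consumed verbatim).
[cite: deShalit1987, II Thm. 4.12 (i)–(ii) (31)–(32), II.4.16 (49)–(50), II.4.17 (52)–(54)] [cite: Muller2020SplitPrimeTwo, Thm. 2.4, Def. 2.5] -/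
theorem vLineRestriction_of_supply (hK : IsImaginaryQuadratic K) (ι : PadicAlgCl 2 ≃+* ℂ)
    {v vbar : HeightOneSpectrum (𝓞 K)} (hv : ((2 : ℕ) : 𝓞 K) ∈ v.asIdeal) (hvbar : ((2 : ℕ) : 𝓞 K) ∈ vbar.asIdeal) (hne : vbar ≠ v)
    (hι : ∀ (w : InfinitePlace K) (k : 𝓞 K), k ∈ v.asIdeal ↔ ‖ι.symm (w.embedding (k : K))‖ < 1)
    {Ω δ : ℂ} {Ωp : (unrIntegers 2)ˣ} (hΩ : Ω ≠ 0)
    {κ₁ κ₂ : ZpExtension K 2} {γ₁ γ₂ : absoluteGaloisGroup K} (hpair : ZpExtension.IsTopGeneratorPair κ₁ κ₂ γ₁ γ₂)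
    (hκ₁ : κ₁.IsUnramifiedOutside v)
    {θ : FramedGaloisRep K (padicCoeffIntegers (∅ : Set (PadicAlgCl 2))) 1} (hθ2 : ∀ σ : absoluteGaloisGroup K, θ σ ^ 2 = 1)
    {θK : HeckeCharacter K} (hH : IsHeckeCharOf ι θ θK)
    {S : Finset (HeightOneSpectrum (𝓞 K))} (hvS : v ∉ S) (hvbS : vbar ∉ S) (hSram : ∀ w ∈ S, ¬ θK.IsUnramifiedAt w)
    (hSunr : ∀ w : HeightOneSpectrum (𝓞 K), w ∉ S → w ≠ v → w ≠ vbar → θK.IsUnramifiedAt w)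
    {G₂ : PowerSeries (PowerSeries (PadicComplexInt 2))}
    (hG₂ : IsKatzMeasure₂ ι v vbar S κ₁ κ₂ γ₁⁻¹ γ₂⁻¹ θK⁻¹ Ω δ ((Ωp : unrIntegers 2) : ℂ_[2]) G₂)
    {S' : Finset (HeightOneSpectrum (𝓞 K))} (hvS' : v ∉ S') (hS'ram : ∀ w ∈ S', ¬ θK.IsUnramifiedAt w)
    (hS'unr : ∀ w : HeightOneSpectrum (𝓞 K), w ∉ S' → w ≠ v → θK.IsUnramifiedAt w)
    {Ω' : ℂ} {Ωp' : (unrIntegers 2)ˣ} {G₁ : PowerSeries (PadicComplexInt 2)} (hΩ' : Ω' ≠ 0)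
    (hG₁ : IsNuBranch ι v S' κ₁ γ₁⁻¹ θK⁻¹ Ω' ((Ωp' : unrIntegers 2) : ℂ_[2]) G₁) (hG₁0 : G₁ ≠ 0)
    (hsupply : ∃ (ρ : ℕ → HeckeCharacter K) (r : ℕ → FramedGaloisRep K (PadicAlgCl 2) 1) (w u : ℂ_[2]) (m₀ N : ℕ),
      0 < m₀ ∧ 0 < N ∧ ‖w - 1‖ < 1 ∧ ‖u - 1‖ < ‖(2 : ℂ_[2])‖ ∧ u ≠ 1 ∧
      ∀ t : ℕ, IsPAdicAvatarOf ι (ρ t) (r t) ∧ FactorsThroughZp κ₁ (r t) ∧ avatarValueAt (r t) γ₁⁻¹ = w * u ^ t ∧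
        (θK⁻¹ * ρ t).HasInfinityType (fun _ ↦ -((m₀ + N * t : ℕ) : ℤ)) (fun _ ↦ 0) ∧
        (∀ w' : HeightOneSpectrum (𝓞 K), w' ≠ v → (ρ t).IsUnramifiedAt w') ∧ (θK⁻¹ * ρ t).IsUnramifiedAt v ∧
        LFunction.HasEntireContinuation (heckeLFunction (θK⁻¹ * ρ t))) :
    PowerSeries.map (PowerSeries.constantCoeff (R := PadicComplexInt 2)) G₂ ≠ 0 ∧
    (θK.IsUnramifiedAt vbar →
      ∀ τ ∈ GreenbergSelmer.decomp vbar, κ₁ τ = κ₁ γ₁ → ∀ u : ℤ,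
        (∀ m : charModule (∅ : Set (PadicAlgCl 2)) θ, τ • m = u • m) →
        Ideal.span ({PowerSeries.map (PowerSeries.constantCoeff (R := PadicComplexInt 2)) G₂} : Set (PowerSeries (PadicComplexInt 2))) =
          Ideal.span {((1 : PowerSeries (PadicComplexInt 2)) + PowerSeries.X) - (u : PowerSeries (PadicComplexInt 2))} *
            Ideal.span {G₁}) ∧
    (¬ θK.IsUnramifiedAt vbar →
      Ideal.span ({PowerSeries.map (PowerSeries.constantCoeff (R := PadicComplexInt 2)) G₂} : Set (PowerSeries (PadicComplexInt 2))) =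
        Ideal.span {G₁}) := by
  have himag : ∀ w : InfinitePlace K, w.IsComplex := fun w ↦ hK.2.isComplex w
  -- §0 Hecke bookkeeping for the quadratic `θ`
  have hθKunr : ∀ w : HeightOneSpectrum (𝓞 K), θK.IsUnramifiedAt w → θ.IsUnramifiedAt w :=
    fun w hw ↦ LinePinThetaOne.isUnramifiedAt_of_isHeckeCharOf ι hθ2 hH hw
  obtain ⟨θK₀, hfin₀, hH₀, -⟩ := QuadraticPart.exists_heckeChar_of_pow_eq_one (∅ : Set (PadicAlgCl 2)) ι θ two_pos hθ2
  have hfin : θK.IsFiniteOrder := by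
    rw [LinePinThetaOne.heckeChar_eq_of_isHeckeCharOf ι hθ2 hH hH₀]; exact hfin₀
  have hθK0 : θK.HasInfinityType (fun _ ↦ (0 : ℤ)) (fun _ ↦ 0) := hasInfinityType_zero_of_isFiniteOrder hfin
  have hθKi0 : θK⁻¹.HasInfinityType (fun _ ↦ (0 : ℤ)) (fun _ ↦ 0) := by
    have h := hθK0.inv
    have e : (-fun _ : InfinitePlace K ↦ (0 : ℤ)) = fun _ ↦ 0 := by funext w; simp
    rwa [e] at h
  -- periods
  have hΩp : ((Ωp : unrIntegers 2) : ℂ_[2]) ≠ 0 := coe_unrIntegers_unit_ne_zero Ωp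
  have hΩp' : ((Ωp' : unrIntegers 2) : ℂ_[2]) ≠ 0 := coe_unrIntegers_unit_ne_zero Ωp'
  -- (i) `P = π_v G₂` is a `ν`-branch of modulus `S ∪ {v̄}`
  have hPnu : IsNuBranch ι v (insert vbar S) κ₁ γ₁⁻¹ θK⁻¹ Ω ((Ωp : unrIntegers 2) : ℂ_[2])
      (PowerSeries.map (PowerSeries.constantCoeff (R := PadicComplexInt 2)) G₂) :=
    (isKatzBranch_map_constantCoeff_of_isUnitGeneratorPair hpair.isUnitGeneratorPair_inv hG₂).isNuBranch
  -- the supply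
  obtain ⟨ρ, r, w, u, m₀, N, hm₀, hN, hw, hu, hu1, hsup⟩ := hsupply
  have h2le : ‖(2 : ℂ_[2])‖ ≤ 1 := by
    have h := norm_prime_padicComplex_lt_one (p := 2)
    exact_mod_cast h.le
  have hu' : ‖u - 1‖ < 1 := hu.trans_le h2le
  have hroot : ∀ n : ℕ, 0 < n → u ^ n ≠ 1 :=
    IntSeries.forall_pow_ne_one_of_norm_sub_one_lt hu1 (by exact_mod_cast hu)
  have hw1 : ‖w‖ ≤ 1 := (norm_eq_one_of_norm_sub_one_lt_one hw).le
  set w₀ : PadicComplexInt 2 := ⟨w, mem_padicComplexInt_iff.mpr hw1⟩ with hw₀def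
  have hw₀ : ‖(w₀ : ℂ_[2]) - 1‖ < 1 := hw
  have hm : ∀ t : ℕ, 0 < m₀ + N * t := fun t ↦ Nat.add_pos_left hm₀ _
  have hnode : ∀ t : ℕ, avatarValueAt (r t) γ₁⁻¹ - 1 = (w₀ : ℂ_[2]) * u ^ t - 1 := fun t ↦ by
    rw [(hsup t).2.2.1]
  have hunrT : ∀ (t : ℕ) (w' : HeightOneSpectrum (𝓞 K)), w' ∉ insert vbar S → (θK⁻¹ * ρ t).IsUnramifiedAt w' := by
    intro t w' hw'
    rw [Finset.mem_insert, not_or] at hw'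
    by_cases hw'v : w' = v
    · subst hw'v; exact (hsup t).2.2.2.2.2.1
    · exact (hSunr w' hw'.2 hw'v hw'.1).inv'.mul' ((hsup t).2.2.2.2.1 w' hw'v)
  have hPval : ∀ t : ℕ, IntSeries.HasValueAt (PowerSeries.map (PowerSeries.constantCoeff (R := PadicComplexInt 2)) G₂)
      ((w₀ : ℂ_[2]) * u ^ t - 1)
      (((ι.symm (interpolationValue₀ 2 v (insert vbar S) (θK⁻¹ * ρ t) (m₀ + N * t) Ω
          ((hsup t).2.2.2.2.2.2.continuation 0)) : PadicAlgCl 2) : ℂ_[2]) * ((Ωp : unrIntegers 2) : ℂ_[2]) ^ (m₀ + N * t)) := by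
    intro t
    rw [← hnode t]
    exact hPnu.hasValueAt (hsup t).1 (hsup t).2.1 (hm t) (hsup t).2.2.2.1 (hunrT t) (hsup t).2.2.2.2.2.2
  -- (ii)/(iii) the two cases
  by_cases hunr : θK.IsUnramifiedAt vbar
  · -- UNRAMIFIED at `v̄`: `S' = S`, Euler factor at `v̄`
    have hS'eq : S' = S := by
      ext w'
      constructor
      · intro hw'
        by_contra h2
        have hw'v : w' ≠ v := fun h ↦ hvS' (h ▸ hw')
        by_cases h1 : w' = vbar
        · exact hS'ram w' hw' (h1 ▸ hunr)
        · exact hS'ram w' hw' (hSunr w' h2 hw'v h1)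
      · intro hw'
        by_contra h2
        exact hSram w' hw' (hS'unr w' h2 (fun h ↦ hvS (h ▸ hw')))
    rw [hS'eq] at hG₁
    have hθv : θ.IsUnramifiedAt vbar := hθKunr vbar hunr
    have hunrS : ∀ (t : ℕ) (w' : HeightOneSpectrum (𝓞 K)), w' ∉ S → (θK⁻¹ * ρ t).IsUnramifiedAt w' := by
      intro t w' hw'
      by_cases hw'v : w' = v
      · subst hw'v; exact (hsup t).2.2.2.2.2.1
      by_cases hw'vb : w' = vbar
      · subst hw'vb; exact hunr.inv'.mul' ((hsup t).2.2.2.2.1 _ hne)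
      · exact (hSunr w' hw' hw'v hw'vb).inv'.mul' ((hsup t).2.2.2.2.1 w' hw'v)
    -- the avatar dictionary at `v̄`
    obtain ⟨φ₀, hφ₀, hdict⟩ := exists_frob_dictionary (p := 2) ι himag hvbar hne hι
    have hc₀ : κ₁ (absGaloisRestrict K (vbar.adicCompletion K) φ₀) ≠ 1 :=
      apply_absGaloisRestrict_ne_one hK hv hvbar hne hκ₁ hφ₀
    -- `a = θ̃((res φ₀)⁻¹) = ι⁻¹ θ_K⁻¹(ϖ_v̄)`
    have hθav : IsPAdicAvatarOf ι θK⁻¹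
        (FramedRep.baseChange (padicCoeffIntegers (∅ : Set (PadicAlgCl 2))).subtype continuous_subtype_val θ) :=
      isPAdicAvatarOf_inv_of_isHeckeCharOf _ ι hH hθKunr
    have hθKT : ∀ w' : HeightOneSpectrum (𝓞 K), w' ∉ insert v (insert vbar S) → θK⁻¹.IsUnramifiedAt w' := by
      intro w' hw'
      simp only [Finset.mem_insert, not_or] at hw'
      exact (hSunr w' hw'.2.2 hw'.1 hw'.2.1).inv'
    have ha : avatarValueAt (FramedRep.baseChange (padicCoeffIntegers (∅ : Set (PadicAlgCl 2))).subtype continuous_subtype_val θ)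
        (absGaloisRestrict K (vbar.adicCompletion K) φ₀)⁻¹ = ((ι.symm (θK⁻¹.valueAtUniformizer vbar) : PadicAlgCl 2) : ℂ_[2]) :=
      hdict θK⁻¹ 0 _ _ hθKT hunr.inv' hθKi0 hθav
    set a : PadicComplexInt 2 := ⟨avatarValueAt (FramedRep.baseChange (padicCoeffIntegers (∅ : Set (PadicAlgCl 2))).subtype
      continuous_subtype_val θ) (absGaloisRestrict K (vbar.adicCompletion K) φ₀)⁻¹, avatarValueAt_mem_padicComplexInt _ _⟩ with ha_def
    -- the dictionary at the supply points
    have hρtype : ∀ t : ℕ, (ρ t).HasInfinityType (fun _ ↦ -((m₀ + N * t : ℕ) : ℤ)) (fun _ ↦ 0) := by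
      intro t
      have h := hθK0.mul' (hsup t).2.2.2.1
      rw [mul_inv_cancel_left] at h
      convert h using 2 <;> simp
    have hρval : ∀ t : ℕ, avatarValueAt (r t) (absGaloisRestrict K (vbar.adicCompletion K) φ₀)⁻¹ =
        ((ι.symm ((ρ t).valueAtUniformizer vbar) : PadicAlgCl 2) : ℂ_[2]) := fun t ↦
      hdict (ρ t) _ {v} (r t) (fun w' hw' ↦ (hsup t).2.2.2.2.1 w' (by simpa using hw'))
        ((hsup t).2.2.2.2.1 vbar hne) (hρtype t) (hsup t).1
    have hval : ∀ t : ℕ, ((ι.symm (heckeValueExtZero (θK⁻¹ * ρ t) vbar) : PadicAlgCl 2) : ℂ_[2]) =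
        (a : ℂ_[2]) * avatarValueAt (r t) (absGaloisRestrict K (vbar.adicCompletion K) φ₀)⁻¹ := by
      intro t
      rw [heckeValueExtZero_of_isUnramifiedAt (hunr.inv'.mul' ((hsup t).2.2.2.2.1 vbar hne)),
        HeckeCharacter.valueAtUniformizer_mul', map_mul, hρval t, ha_def, Subtype.coe_mk, ha]
      push_cast
      rfl
    -- the Euler factor and `Q`
    have hexp : -(Multiplicative.toAdd (κ₁ (absGaloisRestrict K (vbar.adicCompletion K) φ₀)⁻¹)) =
        Multiplicative.toAdd (κ₁ (absGaloisRestrict K (vbar.adicCompletion K) φ₀)) := by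
      rw [map_inv, toAdd_inv, neg_neg]
    have hQval : ∀ t : ℕ, IntSeries.HasValueAt
        ((1 - PowerSeries.C a * IntSeries.binomPow (Multiplicative.toAdd (κ₁ (absGaloisRestrict K (vbar.adicCompletion K) φ₀)))) * G₁)
        ((w₀ : ℂ_[2]) * u ^ t - 1)
        (((ι.symm (interpolationValue₀ 2 v (insert vbar S) (θK⁻¹ * ρ t) (m₀ + N * t) Ω'
            ((hsup t).2.2.2.2.2.2.continuation 0)) : PadicAlgCl 2) : ℂ_[2]) * ((Ωp' : unrIntegers 2) : ℂ_[2]) ^ (m₀ + N * t)) := by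
      intro t
      rw [← hnode t, ← hexp]
      exact hG₁.hasValueAt_insert_of_avatarAt_inv hpair.left hvbS _ a (hsup t).1 (hsup t).2.1 (hm t) (hsup t).2.2.2.1
        (hunrS t) (hval t) (hsup t).2.2.2.2.2.2
    have hE0 : (1 - PowerSeries.C a * IntSeries.binomPow (Multiplicative.toAdd (κ₁ (absGaloisRestrict K (vbar.adicCompletion K) φ₀)))) ≠ 0 := by
      intro hE
      have h0 := congrArg (PowerSeries.constantCoeff (R := PadicComplexInt 2)) hE
      rw [map_sub, map_one, map_mul, PowerSeries.constantCoeff_C, IntSeries.constantCoeff_binomPow, mul_one, map_zero,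
        sub_eq_zero] at h0
      have h1 := congrArg (PowerSeries.coeff (R := PadicComplexInt 2) 1) hE
      rw [map_sub, PowerSeries.coeff_one, if_neg one_ne_zero, PowerSeries.coeff_C_mul, IntSeries.coeff_binomPow,
        Ring.choose_one_right, map_zero, zero_sub, neg_eq_zero, ← h0, one_mul,
        map_eq_zero_iff _ padicIntToComplexInt_injective, toAdd_eq_zero] at h1
      exact hc₀ h1
    have hQ0 : (1 - PowerSeries.C a * IntSeries.binomPow (Multiplicative.toAdd (κ₁ (absGaloisRestrict K (vbar.adicCompletion K) φ₀)))) *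
        G₁ ≠ 0 := mul_ne_zero hE0 hG₁0
    have hspan := span_eq_span_of_interpolationValue₀_values (ε := fun t ↦ θK⁻¹ * ρ t) (m := fun t ↦ m₀ + N * t)
      (L := fun t ↦ (hsup t).2.2.2.2.2.2.continuation 0) hw₀ hu' hroot (fun _ ↦ rfl) hN hΩ hΩ' hΩp hΩp' hPval hQval hQ0
    have hP0 := ne_zero_of_interpolationValue₀_values (ε := fun t ↦ θK⁻¹ * ρ t) (m := fun t ↦ m₀ + N * t)
      (L := fun t ↦ (hsup t).2.2.2.2.2.2.continuation 0) hw₀ hu' hroot hΩ hΩ' hΩp hΩp' hPval hQval hQ0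
    refine ⟨hP0, fun _ τ hτ hκτ uu hum ↦ ?_, fun hram ↦ absurd hunr hram⟩
    -- (iv) the stub's `(τ, u)`
    have hκτ1 : κ₁ τ = Multiplicative.ofAdd 1 := hκτ.trans hpair.left
    have hu1' : uu = 1 ∨ uu = -1 := eq_one_or_eq_neg_one_of_forall_smul hθ2 hum
    have hunit : IsUnit (Multiplicative.toAdd (κ₁ (absGaloisRestrict K (vbar.adicCompletion K) φ₀))) :=
      isUnit_toAdd_apply_absGaloisRestrict (hκ₁.inertia_le hne) hφ₀ hτ hκτ1
    have hθτ : unitChar θ τ = unitChar θ (absGaloisRestrict K (vbar.adicCompletion K) φ₀) :=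
      unitChar_eq_unitChar_absGaloisRestrict (hκ₁.inertia_le hne) θ hθ2 hθv hφ₀ hτ hκτ1
    have hinv : (unitChar θ (absGaloisRestrict K (vbar.adicCompletion K) φ₀))⁻¹ =
        unitChar θ (absGaloisRestrict K (vbar.adicCompletion K) φ₀) := by
      rcases unitChar_eq_one_or_eq_neg_one hθ2 (absGaloisRestrict K (vbar.adicCompletion K) φ₀) with h | h <;> rw [h] <;> simp
    have haU : a = (uu : PadicComplexInt 2) := by
      apply Subtype.ext
      rw [ha_def, Subtype.coe_mk, avatarValueAt_baseChange_subtype_empty_inv, hinv, ← hθτ, ← intCast_eq_unitChar_of_forall_smul θ hum,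
        map_intCast]
    rw [hspan, ← Ideal.span_singleton_mul_span_singleton, haU,
      EulerFactorNorm.span_one_sub_C_mul_binomPow_eq_span_of_isUnit uu hu1' hunit]
  · -- RAMIFIED at `v̄`: `S' = insert v̄ S`, no Euler factor
    have hS'eq : S' = insert vbar S := by
      ext w'
      simp only [Finset.mem_insert]
      constructor
      · intro hw'
        by_cases h1 : w' = vbar
        · exact Or.inl h1
        · right
          by_contra h2
          exact hS'ram w' hw' (hSunr w' h2 (fun h ↦ hvS' (h ▸ hw')) h1)
      · rintro (rfl | hw')
        · by_contra h2
          exact hunr (hS'unr _ h2 hne)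
        · by_contra h2
          exact hSram w' hw' (hS'unr w' h2 (fun h ↦ hvS (h ▸ hw')))
    rw [hS'eq] at hG₁
    have hQval : ∀ t : ℕ, IntSeries.HasValueAt G₁ ((w₀ : ℂ_[2]) * u ^ t - 1)
        (((ι.symm (interpolationValue₀ 2 v (insert vbar S) (θK⁻¹ * ρ t) (m₀ + N * t) Ω'
            ((hsup t).2.2.2.2.2.2.continuation 0)) : PadicAlgCl 2) : ℂ_[2]) * ((Ωp' : unrIntegers 2) : ℂ_[2]) ^ (m₀ + N * t)) := by
      intro t
      rw [← hnode t]
      exact hG₁.hasValueAt (hsup t).1 (hsup t).2.1 (hm t) (hsup t).2.2.2.1 (hunrT t) (hsup t).2.2.2.2.2.2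
    have hspan := span_eq_span_of_interpolationValue₀_values (ε := fun t ↦ θK⁻¹ * ρ t) (m := fun t ↦ m₀ + N * t)
      (L := fun t ↦ (hsup t).2.2.2.2.2.2.continuation 0) hw₀ hu' hroot (fun _ ↦ rfl) hN hΩ hΩ' hΩp hΩp' hPval hQval hG₁0
    have hP0 := ne_zero_of_interpolationValue₀_values (ε := fun t ↦ θK⁻¹ * ρ t) (m := fun t ↦ m₀ + N * t)
      (L := fun t ↦ (hsup t).2.2.2.2.2.2.continuation 0) hw₀ hu' hroot hΩ hΩ' hΩp hΩp' hPval hQval hG₁0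
    exact ⟨hP0, fun h ↦ absurd h hunr, fun _ ↦ hspan⟩

/-- **The same, fed DIRECTLY by cf2c-w3 g6's final supply signature and the stub's Müller clause** (HOME/STATUS 2026-08-29T08:36:02Z: the
`∃` of `VLineSupply.exists_vLineSupply[_of_discr]` with its 12 conjuncts in the printed order; `G₁ ≠ 0` from
`VLineRestriction.ne_zero_of_charIdeal_map_eq_span`). With this corollary the by-name closer of `stub_vLineRestriction` is
`fun … ↦ vLineRestriction_of_supply₁₂ … hM (VLineSupply.exists_vLineSupply_of_discr hK hdisc hv hvbar hne ι hι hpair hκ₁ hθ2 hH)`.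
[cite: deShalit1987, II Thm. 4.12 (i)–(ii) (31)–(32), II.4.16 (49)–(50), II.4.17 (52)–(54)] [cite: Muller2020SplitPrimeTwo, Thm. 2.4, Def. 2.5] -/
theorem vLineRestriction_of_supply₁₂ (hK : IsImaginaryQuadratic K) (ι : PadicAlgCl 2 ≃+* ℂ)
    {v vbar : HeightOneSpectrum (𝓞 K)} (hv : ((2 : ℕ) : 𝓞 K) ∈ v.asIdeal) (hvbar : ((2 : ℕ) : 𝓞 K) ∈ vbar.asIdeal) (hne : vbar ≠ v)
    (hι : ∀ (w : InfinitePlace K) (k : 𝓞 K), k ∈ v.asIdeal ↔ ‖ι.symm (w.embedding (k : K))‖ < 1)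
    {Ω δ : ℂ} {Ωp : (unrIntegers 2)ˣ} (hΩ : Ω ≠ 0)
    {κ₁ κ₂ : ZpExtension K 2} {γ₁ γ₂ : absoluteGaloisGroup K} (hpair : ZpExtension.IsTopGeneratorPair κ₁ κ₂ γ₁ γ₂)
    (hκ₁ : κ₁.IsUnramifiedOutside v)
    {θ : FramedGaloisRep K (padicCoeffIntegers (∅ : Set (PadicAlgCl 2))) 1} (hθ2 : ∀ σ : absoluteGaloisGroup K, θ σ ^ 2 = 1)
    {θK : HeckeCharacter K} (hH : IsHeckeCharOf ι θ θK)
    {S : Finset (HeightOneSpectrum (𝓞 K))} (hvS : v ∉ S) (hvbS : vbar ∉ S) (hSram : ∀ w ∈ S, ¬ θK.IsUnramifiedAt w)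
    (hSunr : ∀ w : HeightOneSpectrum (𝓞 K), w ∉ S → w ≠ v → w ≠ vbar → θK.IsUnramifiedAt w)
    {G₂ : PowerSeries (PowerSeries (PadicComplexInt 2))}
    (hG₂ : IsKatzMeasure₂ ι v vbar S κ₁ κ₂ γ₁⁻¹ γ₂⁻¹ θK⁻¹ Ω δ ((Ωp : unrIntegers 2) : ℂ_[2]) G₂)
    {S' : Finset (HeightOneSpectrum (𝓞 K))} (hvS' : v ∉ S') (hS'ram : ∀ w ∈ S', ¬ θK.IsUnramifiedAt w)
    (hS'unr : ∀ w : HeightOneSpectrum (𝓞 K), w ∉ S' → w ≠ v → θK.IsUnramifiedAt w)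
    {Ω' : ℂ} {Ωp' : (unrIntegers 2)ˣ} {G₁ : PowerSeries (PadicComplexInt 2)} (hΩ' : Ω' ≠ 0)
    (hG₁ : IsNuBranch ι v S' κ₁ γ₁⁻¹ θK⁻¹ Ω' ((Ωp' : unrIntegers 2) : ℂ_[2]) G₁)
    (hM : ∀ D₁ : DatumDualData κ₁ γ₁ (charModule (∅ : Set (PadicAlgCl 2)) θ)
        (Castella2018.AcSelmer.bdpData (charModule (∅ : Set (PadicAlgCl 2)) θ) 2 vbar) ∅,
      Module.Finite (IwasawaAlgebra 2) D₁.X ∧ Module.IsTorsion (IwasawaAlgebra 2) D₁.X ∧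
      ∀ (J : ℤ_[2] →+* PadicComplexInt 2),
        (∀ x : ℤ_[2], ((J x : PadicComplexInt 2) : ℂ_[2]) = ((x : ℚ_[2]) : ℂ_[2])) →
        (Module.charIdeal (IwasawaAlgebra 2) D₁.X).map (PowerSeries.map J) = Ideal.span {G₁})
    (hsupply : ∃ (ρ : ℕ → HeckeCharacter K) (r : ℕ → FramedGaloisRep K (PadicAlgCl 2) 1) (w u : ℂ_[2]) (m₀ N : ℕ),
      0 < m₀ ∧ 0 < N ∧ ‖w - 1‖ < 1 ∧ ‖u - 1‖ < ‖(2 : ℂ_[2])‖ ∧ u ≠ 1 ∧ (∀ n : ℕ, 0 < n → u ^ n ≠ 1) ∧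
      ∀ t : ℕ, IsPAdicAvatarOf ι (ρ t) (r t) ∧ FactorsThroughZp κ₁ (r t) ∧ FactorsThroughPair κ₁ κ₂ (r t) ∧
        avatarValueAt (r t) γ₁⁻¹ = w * u ^ t ∧ avatarValueAt (r t) γ₂⁻¹ = 1 ∧ 0 < m₀ + N * t ∧
        (θK⁻¹ * ρ t).HasInfinityType (fun _ ↦ -((m₀ + N * t : ℕ) : ℤ)) (fun _ ↦ 0) ∧
        (∀ w' : HeightOneSpectrum (𝓞 K), w' ≠ v → (ρ t).IsUnramifiedAt w') ∧ (θK⁻¹ * ρ t).IsUnramifiedAt v ∧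
        (∀ w' : HeightOneSpectrum (𝓞 K), w' ≠ v → θK.IsUnramifiedAt w' → (θK⁻¹ * ρ t).IsUnramifiedAt w') ∧
        LFunction.HasEntireContinuation (heckeLFunction (θK⁻¹ * ρ t))) :
    PowerSeries.map (PowerSeries.constantCoeff (R := PadicComplexInt 2)) G₂ ≠ 0 ∧
    (θK.IsUnramifiedAt vbar →
      ∀ τ ∈ GreenbergSelmer.decomp vbar, κ₁ τ = κ₁ γ₁ → ∀ u : ℤ,
        (∀ m : charModule (∅ : Set (PadicAlgCl 2)) θ, τ • m = u • m) →
        Ideal.span ({PowerSeries.map (PowerSeries.constantCoeff (R := PadicComplexInt 2)) G₂} : Set (PowerSeries (PadicComplexInt 2))) =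
          Ideal.span {((1 : PowerSeries (PadicComplexInt 2)) + PowerSeries.X) - (u : PowerSeries (PadicComplexInt 2))} *
            Ideal.span {G₁}) ∧
    (¬ θK.IsUnramifiedAt vbar →
      Ideal.span ({PowerSeries.map (PowerSeries.constantCoeff (R := PadicComplexInt 2)) G₂} : Set (PowerSeries (PadicComplexInt 2))) =
        Ideal.span {G₁}) := by
  obtain ⟨ρ, r, w, u, m₀, N, hm₀, hN, hw, hu, hu1, -, hsup⟩ := hsupply
  exact vLineRestriction_of_supply hK ι hv hvbar hne hι hΩ hpair hκ₁ hθ2 hH hvS hvbS hSram hSunr hG₂ hvS' hS'ram hS'unr hΩ' hG₁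
    (ne_zero_of_charIdeal_map_eq_span hpair.left θ vbar hM)
    ⟨ρ, r, w, u, m₀, N, hm₀, hN, hw, hu, hu1, fun t ↦ ⟨(hsup t).1, (hsup t).2.1, (hsup t).2.2.2.1, (hsup t).2.2.2.2.2.2.1,
      (hsup t).2.2.2.2.2.2.2.1, (hsup t).2.2.2.2.2.2.2.2.1, (hsup t).2.2.2.2.2.2.2.2.2.2⟩⟩

end Summit.BirchSwinnertonDyer.Rank1Residual.P2.VLineRestriction

end
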